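import Mathlib
import HarnessLib
import Summits.NavierStokesRegularity.NavierStokesRegularity.Theorems.PoloidalWindowDoorPoloidalWindowRigidityThmARelocation
import Summits.NavierStokesRegularity.NavierStokesRegularity.Theorems.PoloidalWindowDoorPoloidalWindowRigidityThmASemiEllipticThick

/-!
# Theorem A, census form: the twisting stub from THREE typed stubs (hyperbolic-(TH), hyperbolic-thick, semi-elliptic-thick)

Seat ns-poloidal-K2-p2 g6 (interim lead-of-record on crux K2 `PoloidalWindowRigidity` = stmt-NavierStokesRegularity-19708;
line `mixed_type` v1; item stmt-20428 `LrcModEntire`).  The composition of the `mixed_type` skeleton (cstrat-19708,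
`twisting_of_mixedType`: type dichotomy with relocation), moved to the kernel with `stub_semiElliptic` replaced by its THICK part
(`…ThmASemiEllipticThick.semiElliptic_regular_of_thick`, which rests on Theorem A's class form):

* `twisting_regular_of_three` — for a profile of the route's class: IF (hyperbolic + (TH) windows ⇒ regular), (hyperbolic + thick
  windows ⇒ regular) and (semi-elliptic-slab + thick windows ⇒ regular), THEN every nonempty open non-degenerate + pinned + twisting
  window forces `¬ IsBackwardSingularPoint v 0` — VERBATIM the statement of `lrc_jet` v5 `stub_twisting` for this profile.

So a `mixed_type` v2 skeleton is: three stubs (`stub_hyperbolicTH`, `stub_hyperbolicThick`, `stub_semiEllipticThick`) + ONE call of this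
theorem; the (TH) stratum occurs only in its hyperbolic dress.  Relocation text adapted from cstrat's skeleton; toolkit from `…ThmARelocation`.
WHAT THIS IS NOT: not a proof of K2 and not a claim about Navier–Stokes regularity (bears_on LADDER-NS N0 via crux 19708 / item 20428).
-/

-- the summit and its single sub-problem share the name (CONVENTIONS §1)
set_option linter.dupNamespace false

noncomputable section

namespace Summit.NavierStokesRegularity.NavierStokesRegularity.Theorems.PoloidalWindowDoorPoloidalWindowRigidityThmAThreeStubs

open Set Function Filter Topology Metric
open scoped RealInnerProductSpace InnerProductSpace
open Literature.Analysis Literature.Analysis.FluidPDE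
open Summit.NavierStokesRegularity.NavierStokesRegularity.Theorems.PoloidalWindowDoorPoloidalWindowRigidityThmARelocation
open Summit.NavierStokesRegularity.NavierStokesRegularity.Theorems.PoloidalWindowDoorPoloidalWindowRigidityThmASemiEllipticThick

/-- **NON-DEGENERATE + PIN + TWISTING ⇒ regular, from the three typed stubs** (statement of `lrc_jet` v5 `stub_twisting` for the given
class profile).  See the file header. [folklore] -/
theorem twisting_regular_of_three (C : ℝ) (v : ℝ → EuclideanSpace ℝ (Fin 3) → EuclideanSpace ℝ (Fin 3))
    (hrate : Literature.Analysis.FluidPDE.HasTypeITimeDecay C v)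
    (hcont : ContinuousOn (Function.uncurry v) (Set.Iio (0 : ℝ) ×ˢ Set.univ))
    (hmild : ∀ s t : ℝ, s < t → t < 0 → ∀ x, v t x =
      Literature.Analysis.UnboundedOperators.heatExtension (v s) (t - s) x -
        Literature.Analysis.FluidPDE.oseenDuhamel 1 s v v t x)
    (hdiv : ∀ t < 0, Literature.Analysis.FluidPDE.VectorCalculus.IsDivFree (v t))
    (hH : ∀ W' : Set (ℝ × EuclideanSpace ℝ (Fin 3)), IsOpen W' → W'.Nonempty → W' ⊆ Set.Iio (0 : ℝ) ×ˢ Set.univ →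
      (∀ z ∈ W', Literature.Analysis.FluidPDE.curl (v z.1) z.2 ≠ 0 ∧
        (fderiv ℝ (v z.1) z.2 (EuclideanSpace.single 0 1) 2 ≠ 0 ∨ fderiv ℝ (v z.1) z.2 (EuclideanSpace.single 1 1) 2 ≠ 0) ∧
        (fderiv ℝ (v z.1) z.2 (EuclideanSpace.single 2 1) 0 ≠ 0 ∨ fderiv ℝ (v z.1) z.2 (EuclideanSpace.single 2 1) 1 ≠ 0)) →
      (∀ m : ℝ → ℝ, ∀ W₁ : Set (ℝ × EuclideanSpace ℝ (Fin 3)), W₁ ⊆ W' → IsOpen W₁ → W₁.Nonempty →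
        ∃ z ∈ W₁, ∃ b : Fin 3, b ≠ 2 ∧
          fderiv ℝ (v z.1) z.2 (EuclideanSpace.single 2 1) b ≠
            m z.1 * fderiv ℝ (v z.1) z.2 (EuclideanSpace.single b 1) 2) →
      (∀ z ∈ W',
        fderiv ℝ (fun x => fderiv ℝ (v z.1) x (EuclideanSpace.single 2 1) 2) z.2 (EuclideanSpace.single 0 1) *
            fderiv ℝ (v z.1) z.2 (EuclideanSpace.single 1 1) 2 -
          fderiv ℝ (fun x => fderiv ℝ (v z.1) x (EuclideanSpace.single 2 1) 2) z.2 (EuclideanSpace.single 1 1) *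
            fderiv ℝ (v z.1) z.2 (EuclideanSpace.single 0 1) 2 ≠ 0) →
      (∀ z ∈ W',
        fderiv ℝ (v z.1) z.2 (EuclideanSpace.single 2 1) 0 * fderiv ℝ (v z.1) z.2 (EuclideanSpace.single 0 1) 2 +
          fderiv ℝ (v z.1) z.2 (EuclideanSpace.single 2 1) 1 * fderiv ℝ (v z.1) z.2 (EuclideanSpace.single 1 1) 2 < 0) →
      (∃ m : ℝ → ℝ → ℝ, ∀ z ∈ W', ∀ b : Fin 3, b ≠ 2 →
        fderiv ℝ (v z.1) z.2 (EuclideanSpace.single 2 1) b =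
          m z.1 (z.2 2) * fderiv ℝ (v z.1) z.2 (EuclideanSpace.single b 1) 2) →
      ¬ Literature.Analysis.FluidPDE.IsBackwardSingularPoint v 0)
    (hHT : ∀ W' : Set (ℝ × EuclideanSpace ℝ (Fin 3)), IsOpen W' → W'.Nonempty → W' ⊆ Set.Iio (0 : ℝ) ×ˢ Set.univ →
      (∀ z ∈ W', Literature.Analysis.FluidPDE.curl (v z.1) z.2 ≠ 0 ∧
        (fderiv ℝ (v z.1) z.2 (EuclideanSpace.single 0 1) 2 ≠ 0 ∨ fderiv ℝ (v z.1) z.2 (EuclideanSpace.single 1 1) 2 ≠ 0) ∧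
        (fderiv ℝ (v z.1) z.2 (EuclideanSpace.single 2 1) 0 ≠ 0 ∨ fderiv ℝ (v z.1) z.2 (EuclideanSpace.single 2 1) 1 ≠ 0)) →
      (∀ m : ℝ → ℝ, ∀ W₁ : Set (ℝ × EuclideanSpace ℝ (Fin 3)), W₁ ⊆ W' → IsOpen W₁ → W₁.Nonempty →
        ∃ z ∈ W₁, ∃ b : Fin 3, b ≠ 2 ∧
          fderiv ℝ (v z.1) z.2 (EuclideanSpace.single 2 1) b ≠
            m z.1 * fderiv ℝ (v z.1) z.2 (EuclideanSpace.single b 1) 2) →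
      (∀ z ∈ W',
        fderiv ℝ (fun x => fderiv ℝ (v z.1) x (EuclideanSpace.single 2 1) 2) z.2 (EuclideanSpace.single 0 1) *
            fderiv ℝ (v z.1) z.2 (EuclideanSpace.single 1 1) 2 -
          fderiv ℝ (fun x => fderiv ℝ (v z.1) x (EuclideanSpace.single 2 1) 2) z.2 (EuclideanSpace.single 1 1) *
            fderiv ℝ (v z.1) z.2 (EuclideanSpace.single 0 1) 2 ≠ 0) →
      (∀ z ∈ W',
        fderiv ℝ (v z.1) z.2 (EuclideanSpace.single 2 1) 0 * fderiv ℝ (v z.1) z.2 (EuclideanSpace.single 0 1) 2 +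
          fderiv ℝ (v z.1) z.2 (EuclideanSpace.single 2 1) 1 * fderiv ℝ (v z.1) z.2 (EuclideanSpace.single 1 1) 2 < 0) →
      (∀ m : ℝ → ℝ → ℝ, ∀ W₁ : Set (ℝ × EuclideanSpace ℝ (Fin 3)), W₁ ⊆ W' → IsOpen W₁ → W₁.Nonempty →
        ∃ z ∈ W₁, ∃ b : Fin 3, b ≠ 2 ∧
          fderiv ℝ (v z.1) z.2 (EuclideanSpace.single 2 1) b ≠
            m z.1 (z.2 2) * fderiv ℝ (v z.1) z.2 (EuclideanSpace.single b 1) 2) →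
      ¬ Literature.Analysis.FluidPDE.IsBackwardSingularPoint v 0)
    (hST : ∀ W' : Set (ℝ × EuclideanSpace ℝ (Fin 3)), IsOpen W' → W'.Nonempty → W' ⊆ Set.Iio (0 : ℝ) ×ˢ Set.univ →
      (∀ z ∈ W', Literature.Analysis.FluidPDE.curl (v z.1) z.2 ≠ 0 ∧
        (fderiv ℝ (v z.1) z.2 (EuclideanSpace.single 0 1) 2 ≠ 0 ∨ fderiv ℝ (v z.1) z.2 (EuclideanSpace.single 1 1) 2 ≠ 0) ∧
        (fderiv ℝ (v z.1) z.2 (EuclideanSpace.single 2 1) 0 ≠ 0 ∨ fderiv ℝ (v z.1) z.2 (EuclideanSpace.single 2 1) 1 ≠ 0)) →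
      (∀ m : ℝ → ℝ, ∀ W₁ : Set (ℝ × EuclideanSpace ℝ (Fin 3)), W₁ ⊆ W' → IsOpen W₁ → W₁.Nonempty →
        ∃ z ∈ W₁, ∃ b : Fin 3, b ≠ 2 ∧
          fderiv ℝ (v z.1) z.2 (EuclideanSpace.single 2 1) b ≠
            m z.1 * fderiv ℝ (v z.1) z.2 (EuclideanSpace.single b 1) 2) →
      (∀ z ∈ W',
        fderiv ℝ (fun x => fderiv ℝ (v z.1) x (EuclideanSpace.single 2 1) 2) z.2 (EuclideanSpace.single 0 1) *
            fderiv ℝ (v z.1) z.2 (EuclideanSpace.single 1 1) 2 -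
          fderiv ℝ (fun x => fderiv ℝ (v z.1) x (EuclideanSpace.single 2 1) 2) z.2 (EuclideanSpace.single 1 1) *
            fderiv ℝ (v z.1) z.2 (EuclideanSpace.single 0 1) 2 ≠ 0) →
      ∀ a b : ℝ, W' ⊆ Set.Ioo a b ×ˢ Set.univ →
        (∀ s ∈ Set.Ioo a b, ∀ y : EuclideanSpace ℝ (Fin 3),
          0 ≤ fderiv ℝ (v s) y (EuclideanSpace.single 2 1) 0 * fderiv ℝ (v s) y (EuclideanSpace.single 0 1) 2 +
            fderiv ℝ (v s) y (EuclideanSpace.single 2 1) 1 * fderiv ℝ (v s) y (EuclideanSpace.single 1 1) 2) →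
        (∀ m : ℝ → ℝ → ℝ, ∀ W₁ : Set (ℝ × EuclideanSpace ℝ (Fin 3)), W₁ ⊆ W' → IsOpen W₁ → W₁.Nonempty →
        ∃ z ∈ W₁, ∃ b : Fin 3, b ≠ 2 ∧
          fderiv ℝ (v z.1) z.2 (EuclideanSpace.single 2 1) b ≠
            m z.1 (z.2 2) * fderiv ℝ (v z.1) z.2 (EuclideanSpace.single b 1) 2) →
        ¬ Literature.Analysis.FluidPDE.IsBackwardSingularPoint v 0)
    (W : Set (ℝ × EuclideanSpace ℝ (Fin 3))) (hW : IsOpen W) (hWne : W.Nonempty) (hWs : W ⊆ Set.Iio (0 : ℝ) ×ˢ Set.univ)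
    (hnd : ∀ z ∈ W, Literature.Analysis.FluidPDE.curl (v z.1) z.2 ≠ 0 ∧
        (fderiv ℝ (v z.1) z.2 (EuclideanSpace.single 0 1) 2 ≠ 0 ∨ fderiv ℝ (v z.1) z.2 (EuclideanSpace.single 1 1) 2 ≠ 0) ∧
        (fderiv ℝ (v z.1) z.2 (EuclideanSpace.single 2 1) 0 ≠ 0 ∨ fderiv ℝ (v z.1) z.2 (EuclideanSpace.single 2 1) 1 ≠ 0))
    (hpin : ∀ m : ℝ → ℝ, ∀ W₁ : Set (ℝ × EuclideanSpace ℝ (Fin 3)), W₁ ⊆ W → IsOpen W₁ → W₁.Nonempty →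
        ∃ z ∈ W₁, ∃ b : Fin 3, b ≠ 2 ∧
          fderiv ℝ (v z.1) z.2 (EuclideanSpace.single 2 1) b ≠
            m z.1 * fderiv ℝ (v z.1) z.2 (EuclideanSpace.single b 1) 2)
    (htw : ∀ z ∈ W,
        fderiv ℝ (fun x => fderiv ℝ (v z.1) x (EuclideanSpace.single 2 1) 2) z.2 (EuclideanSpace.single 0 1) *
            fderiv ℝ (v z.1) z.2 (EuclideanSpace.single 1 1) 2 -
          fderiv ℝ (fun x => fderiv ℝ (v z.1) x (EuclideanSpace.single 2 1) 2) z.2 (EuclideanSpace.single 1 1) *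
            fderiv ℝ (v z.1) z.2 (EuclideanSpace.single 0 1) 2 ≠ 0) :
    ¬ Literature.Analysis.FluidPDE.IsBackwardSingularPoint v 0 := by
  classical
  -- the type scalar and the twist bracket as curried space–time functions
  set I : ℝ → EuclideanSpace ℝ (Fin 3) → ℝ := fun s y =>
    fderiv ℝ (v s) y (EuclideanSpace.single 2 1) 0 * fderiv ℝ (v s) y (EuclideanSpace.single 0 1) 2 +
      fderiv ℝ (v s) y (EuclideanSpace.single 2 1) 1 * fderiv ℝ (v s) y (EuclideanSpace.single 1 1) 2 with hI
  set T : ℝ → EuclideanSpace ℝ (Fin 3) → ℝ := fun s y =>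
    fderiv ℝ (fun x => fderiv ℝ (v s) x (EuclideanSpace.single 2 1) 2) y (EuclideanSpace.single 0 1) *
        fderiv ℝ (v s) y (EuclideanSpace.single 1 1) 2 -
      fderiv ℝ (fun x => fderiv ℝ (v s) x (EuclideanSpace.single 2 1) 2) y (EuclideanSpace.single 1 1) *
        fderiv ℝ (v s) y (EuclideanSpace.single 0 1) 2 with hT
  -- a product box around a point of `W`, inside `W` and inside the backward slab
  obtain ⟨z₀, hz₀⟩ := hWne
  have hs₀ : z₀.1 < 0 := (Set.mem_prod.1 (hWs hz₀)).1
  obtain ⟨ε, hε, hballW⟩ := Metric.isOpen_iff.1 hW z₀ hz₀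
  obtain ⟨r, hr0, hrε, hrs⟩ : ∃ r : ℝ, 0 < r ∧ r ≤ ε ∧ r ≤ -z₀.1 :=
    ⟨min ε (-z₀.1), lt_min hε (by linarith), min_le_left _ _, min_le_right _ _⟩
  have hbox : Set.Ioo (z₀.1 - r) (z₀.1 + r) ×ˢ Metric.ball z₀.2 r ⊆ W := by
    intro z hz
    apply hballW
    have h1 : z ∈ Metric.ball z₀.1 r ×ˢ Metric.ball z₀.2 r := by
      rw [Real.ball_eq_Ioo]; exact hz
    rw [ball_prod_same] at h1
    exact Metric.ball_subset_ball hrε h1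
  have hJneg : ∀ s ∈ Set.Ioo (z₀.1 - r) (z₀.1 + r), s < 0 := fun s hs => by linarith [hs.2]
  by_cases hhyp : ∃ s ∈ Set.Ioo (z₀.1 - r) (z₀.1 + r), ∃ y : EuclideanSpace ℝ (Fin 3), I s y < 0
  · -- A HYPERBOLIC POINT: relocate the twisting window to it
    obtain ⟨s, hsJ, y, hy⟩ := hhyp
    have hs : s < 0 := hJneg s hsJ
    have hsW : (s, z₀.2) ∈ W := hbox (Set.mk_mem_prod hsJ (Metric.mem_ball_self hr0))
    have hT₀ : T s z₀.2 ≠ 0 := htw _ hsW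
    obtain ⟨y₂, hIy₂, hTy₂⟩ : ∃ y₂ : EuclideanSpace ℝ (Fin 3), I s y₂ < 0 ∧ T s y₂ ≠ 0 := by
      by_contra hcon
      push Not at hcon
      have hUo : IsOpen {y' : EuclideanSpace ℝ (Fin 3) | I s y' < 0} := by
        have hc : Continuous (I s) := by
          rw [hI]
          exact (typeScalar_analyticOnNhd_slice hrate hcont hmild hs).continuous
        exact isOpen_lt hc continuous_const
      have hTan : AnalyticOnNhd ℝ (T s) univ := by
        rw [hT]
        exact twist_analyticOnNhd_slice hrate hcont hmild hs
      have hev : T s =ᶠ[𝓝 y] 0 := by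
        filter_upwards [hUo.mem_nhds hy] with y' hy'
        exact hcon y' hy'
      have hzero := hTan.eqOn_zero_of_preconnected_of_eventuallyEq_zero isPreconnected_univ (Set.mem_univ y) hev
      exact hT₀ (hzero (Set.mem_univ z₀.2))
    have hslab : IsOpen (Set.Iio (0 : ℝ) ×ˢ (Set.univ : Set (EuclideanSpace ℝ (Fin 3)))) :=
      isOpen_Iio.prod isOpen_univ
    have hAo : IsOpen ((Set.Iio (0 : ℝ) ×ˢ Set.univ) ∩
        (fun z : ℝ × EuclideanSpace ℝ (Fin 3) => I z.1 z.2) ⁻¹' Set.Iio 0) := by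
      have hc : ContinuousOn (fun z : ℝ × EuclideanSpace ℝ (Fin 3) => I z.1 z.2) (Set.Iio (0 : ℝ) ×ˢ Set.univ) := by
        rw [hI]
        exact continuousOn_typeScalar hrate hcont hmild
      exact hc.isOpen_inter_preimage hslab isOpen_Iio
    have hBo : IsOpen ((Set.Iio (0 : ℝ) ×ˢ Set.univ) ∩
        (fun z : ℝ × EuclideanSpace ℝ (Fin 3) => T z.1 z.2) ⁻¹' {0}ᶜ) := by
      have hc : ContinuousOn (fun z : ℝ × EuclideanSpace ℝ (Fin 3) => T z.1 z.2) (Set.Iio (0 : ℝ) ×ˢ Set.univ) := by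
        rw [hT]
        exact continuousOn_twist hrate hcont hmild
      exact hc.isOpen_inter_preimage hslab isOpen_compl_singleton
    set W' : Set (ℝ × EuclideanSpace ℝ (Fin 3)) :=
      (Set.Ioo (z₀.1 - r) (z₀.1 + r) ×ˢ Set.univ) ∩
        (((Set.Iio (0 : ℝ) ×ˢ Set.univ) ∩ (fun z : ℝ × EuclideanSpace ℝ (Fin 3) => I z.1 z.2) ⁻¹' Set.Iio 0) ∩
         ((Set.Iio (0 : ℝ) ×ˢ Set.univ) ∩ (fun z : ℝ × EuclideanSpace ℝ (Fin 3) => T z.1 z.2) ⁻¹' {0}ᶜ)) with hW'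
    have hW'o : IsOpen W' := (isOpen_Ioo.prod isOpen_univ).inter (hAo.inter hBo)
    have hW'ne : W'.Nonempty :=
      ⟨(s, y₂), Set.mk_mem_prod hsJ (Set.mem_univ _),
        ⟨Set.mk_mem_prod hs (Set.mem_univ _), hIy₂⟩, ⟨Set.mk_mem_prod hs (Set.mem_univ _), hTy₂⟩⟩
    have hW's : W' ⊆ Set.Iio (0 : ℝ) ×ˢ Set.univ := fun z hz => hz.2.1.1
    have hW'J : ∀ z ∈ W', z.1 ∈ Set.Ioo (z₀.1 - r) (z₀.1 + r) := fun z hz => (Set.mem_prod.1 hz.1).1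
    have hW'I : ∀ z ∈ W', I z.1 z.2 < 0 := fun z hz => hz.2.1.2
    have hW'T : ∀ z ∈ W', T z.1 z.2 ≠ 0 := fun z hz => hz.2.2.2
    have hW'nd : ∀ z ∈ W', Literature.Analysis.FluidPDE.curl (v z.1) z.2 ≠ 0 ∧
        (fderiv ℝ (v z.1) z.2 (EuclideanSpace.single 0 1) 2 ≠ 0 ∨ fderiv ℝ (v z.1) z.2 (EuclideanSpace.single 1 1) 2 ≠ 0) ∧
        (fderiv ℝ (v z.1) z.2 (EuclideanSpace.single 2 1) 0 ≠ 0 ∨ fderiv ℝ (v z.1) z.2 (EuclideanSpace.single 2 1) 1 ≠ 0) :=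
      fun z hz => nd_of_typeScalar_neg (v z.1) z.2 (hW'I z hz)
    -- the pin transfers to the relocated window (identity theorem on each slice)
    have hW'pin : ∀ m : ℝ → ℝ, ∀ W₁ : Set (ℝ × EuclideanSpace ℝ (Fin 3)), W₁ ⊆ W' → IsOpen W₁ → W₁.Nonempty →
        ∃ z ∈ W₁, ∃ b : Fin 3, b ≠ 2 ∧
          fderiv ℝ (v z.1) z.2 (EuclideanSpace.single 2 1) b ≠
            m z.1 * fderiv ℝ (v z.1) z.2 (EuclideanSpace.single b 1) 2 := by
      intro m W₁ hW₁ hW₁o hW₁ne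
      by_contra hcon
      push Not at hcon
      obtain ⟨z₁, hz₁⟩ := hW₁ne
      obtain ⟨ρ, hρ, hballρ⟩ := Metric.isOpen_iff.1 hW₁o z₁ hz₁
      have hz₁J : z₁.1 ∈ Set.Ioo (z₀.1 - r) (z₀.1 + r) := hW'J z₁ (hW₁ hz₁)
      set W₂ : Set (ℝ × EuclideanSpace ℝ (Fin 3)) :=
        (Metric.ball z₁.1 ρ ∩ Set.Ioo (z₀.1 - r) (z₀.1 + r)) ×ˢ Metric.ball z₀.2 r with hW₂
      have hW₂W : W₂ ⊆ W := fun z hz =>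
        hbox (Set.mem_prod.2 ⟨(Set.mem_prod.1 hz).1.2, (Set.mem_prod.1 hz).2⟩)
      have hW₂o : IsOpen W₂ := (Metric.isOpen_ball.inter isOpen_Ioo).prod Metric.isOpen_ball
      have hW₂ne : W₂.Nonempty :=
        ⟨(z₁.1, z₀.2), Set.mk_mem_prod ⟨Metric.mem_ball_self hρ, hz₁J⟩ (Metric.mem_ball_self hr0)⟩
      obtain ⟨z, hzW₂, b, hb, hne⟩ := hpin m W₂ hW₂W hW₂o hW₂ne
      have hzt : z.1 ∈ Metric.ball z₁.1 ρ := (Set.mem_prod.1 hzW₂).1.1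
      have hzneg : z.1 < 0 := hJneg _ (Set.mem_prod.1 hzW₂).1.2
      have hrel : ∀ y' ∈ Metric.ball z₁.2 ρ,
          fderiv ℝ (v z.1) y' (EuclideanSpace.single 2 1) b = m z.1 * fderiv ℝ (v z.1) y' (EuclideanSpace.single b 1) 2 := by
        intro y' hy'
        have hmem' : (z.1, y') ∈ Metric.ball z₁.1 ρ ×ˢ Metric.ball z₁.2 ρ := Set.mk_mem_prod hzt hy'
        rw [ball_prod_same] at hmem'
        exact hcon _ (hballρ hmem') b hb
      have han := shearDefect_analyticOnNhd_slice hrate hcont hmild (m z.1) b hzneg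
      have hev : (fun y' => fderiv ℝ (v z.1) y' (EuclideanSpace.single 2 1) b -
          m z.1 * fderiv ℝ (v z.1) y' (EuclideanSpace.single b 1) 2) =ᶠ[𝓝 z₁.2] 0 := by
        filter_upwards [Metric.isOpen_ball.mem_nhds (Metric.mem_ball_self hρ)] with y' hy'
        show _ - _ = (0 : ℝ)
        rw [hrel y' hy', sub_self]
      have hzero := han.eqOn_zero_of_preconnected_of_eventuallyEq_zero isPreconnected_univ (Set.mem_univ z₁.2) hev
      have h0 : fderiv ℝ (v z.1) z.2 (EuclideanSpace.single 2 1) b -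
          m z.1 * fderiv ℝ (v z.1) z.2 (EuclideanSpace.single b 1) 2 = 0 := hzero (Set.mem_univ z.2)
      exact hne (sub_eq_zero.1 h0)
    -- (TH) on a sub-window, or thick
    by_cases hTH : ∃ m : ℝ → ℝ → ℝ, ∃ W₁ : Set (ℝ × EuclideanSpace ℝ (Fin 3)), W₁ ⊆ W' ∧ IsOpen W₁ ∧ W₁.Nonempty ∧
        ∀ z ∈ W₁, ∀ b : Fin 3, b ≠ 2 →
          fderiv ℝ (v z.1) z.2 (EuclideanSpace.single 2 1) b =
            m z.1 (z.2 2) * fderiv ℝ (v z.1) z.2 (EuclideanSpace.single b 1) 2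
    · obtain ⟨m, W₁, hW₁W, hW₁, hW₁ne, hid⟩ := hTH
      exact hH W₁ hW₁ hW₁ne (hW₁W.trans hW's) (fun z hz => hW'nd z (hW₁W hz))
        (fun m' W₂ hW₂ hW₂o hW₂ne => hW'pin m' W₂ (hW₂.trans hW₁W) hW₂o hW₂ne)
        (fun z hz => hW'T z (hW₁W hz)) (fun z hz => hW'I z (hW₁W hz)) ⟨m, hid⟩
    · push Not at hTH
      refine hHT W' hW'o hW'ne hW's hW'nd hW'pin hW'T hW'I fun m W₁ h1 h2 h3 => ?_
      obtain ⟨z, hz, b', hb', hne⟩ := hTH m W₁ h1 h2 h3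
      exact ⟨z, hz, b', hb', hne⟩
  · -- NO HYPERBOLIC POINT IN THE SLAB: every slice of the box is semi-elliptic
    push Not at hhyp
    set W₀ : Set (ℝ × EuclideanSpace ℝ (Fin 3)) := Set.Ioo (z₀.1 - r) (z₀.1 + r) ×ˢ Metric.ball z₀.2 r with hW₀
    have hW₀W : W₀ ⊆ W := hbox
    have hz₀W₀ : z₀ ∈ W₀ :=
      Set.mem_prod.2 ⟨⟨by linarith, by linarith⟩, Metric.mem_ball_self hr0⟩
    exact semiElliptic_regular_of_thick C v hrate hcont hmild hdiv hST W₀ (isOpen_Ioo.prod Metric.isOpen_ball) ⟨z₀, hz₀W₀⟩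
      (hW₀W.trans hWs) (fun z hz => hnd z (hW₀W hz))
      (fun m W₁ hW₁ hW₁o hW₁ne => hpin m W₁ (hW₁.trans hW₀W) hW₁o hW₁ne) (fun z hz => htw z (hW₀W hz))
      (z₀.1 - r) (z₀.1 + r) (Set.prod_mono le_rfl (Set.subset_univ _)) hhyp

end Summit.NavierStokesRegularity.NavierStokesRegularity.Theorems.PoloidalWindowDoorPoloidalWindowRigidityThmAThreeStubs

end
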